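import Summits.QuantumFields.YangMills.Theorems.LuscherReductionTwistedTraceScalingBTDiagonalAverage
import Summits.QuantumFields.YangMills.Theorems.LuscherReductionTwistedTraceScalingBTDiagonalRatio
import Summits.QuantumFields.YangMills.Theorems.LuscherReductionTwistedTraceScalingBTProductForm
import HarnessLib

/-!
# (L3) INTEGRATED: the diagonal factor `f(u) = fpBOKernel β Ω W u u / K₁^{(L³β)}(u,u)` is `f(1)·(1 ± O(ε₂ + ε₁²))` whenever the pointwise sandwich hypotheses hold on the support
# (lane A of S-BASE, crux `TwistedTraceScaling` stmt-QuantumFields-20203, C4-CORE, the (B-T) pen; design note `pub/ym-fleet/ym-luscher-20007-p1/COARSE-DESIGN.md` §25.7–§25.8)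

Assembly of `…BTColourInvariance` (`f(dud⁻¹) = f(u)`), `…BTProductForm` (`fpBOKernel` = one integral of `fpTriple`), `…BTDiagonalRatio` (the integrand at `u` is the integrand at `1` times
`exp(diagX)`) and `…BTDiagonalAverage` (the Haar sandwich, pointwise): for a colour-blind `Ω ≥ 0` and a CONJUGATION-invariant weight `W ≥ 0` (the FP weight of record times the indicator of a
rotation-invariant g-core), if the explicit second-order quantities of `haar_integral_exp_diagX_sandwich` are `≤ ε₁, ε₂` uniformly on `supp Ω × supp Ω × supp W` (cap data `≤ τ ≤ 1/30`), then
★★★ `fpBOKernel_diag_two_sided`: `(1 − ε₂)·f(1) ≤ f(u) ≤ (1 + ε₂ + (ε₁+ε₂)²)·f(1)`.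
HONEST FRAMING: Fubini bookkeeping for a stub of a child of the CONDITIONAL reduction route R2b1; the tails/(L1)/(L2) of the Laplace core of (B-T) remain OPEN; C4-CORE OPEN; not infinite volume,
not a gap, not Clay.
-/

set_option autoImplicit false

noncomputable section

open MeasureTheory Filter Topology Real
open scoped BigOperators
open Literature.MathematicalPhysics.QuantumFieldTheory
open Literature.MathematicalPhysics.QuantumLattice

namespace Summit.QuantumFields.YangMills.Theorems.FemtoTransferGap.TwoLattice.ConstTube

open Summit.QuantumFields.YangMills.Theorems.FemtoTransferGap
open Summit.QuantumFields.YangMills.Theorems.FemtoTransferGap.TwoLattice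
open Summit.QuantumFields.YangMills.Theorems.FemtoTransferGap.TwoLattice.Avg
open Summit.QuantumFields.YangMills.Theorems.FemtoTransferGap.TwoLattice.Cov
open Summit.QuantumFields.YangMills.Theorems.FemtoTransferGap.TwoLattice.Stiff (LinkSpace)

variable {L : ℕ} [NeZero L]

/-! ## §1 The integrand at a conjugate slow datum -/

/-- ★ Pointwise: `fpTriple(dud⁻¹,dud⁻¹)(p) / K₁(u,u) = [fpTriple(1,1)(p) / K₁(1,1)] · exp(diagX β (dud⁻¹) v v' g)`. [cite: Luscher1983, §3] -/
theorem fpTriple_conj_div_eq (β : ℝ) (Ω : LinkSpace L → ℝ) (W : (Site 3 L → SU2) → ℝ) (u : GaugeConfig 3 1 SU2) (d : SU2)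
    (p : (Edge 3 L → Fin 3 → ℝ) × ((Edge 3 L → Fin 3 → ℝ) × (Site 3 L → SU2))) :
    fpTriple L β Ω W (gaugeTransform (fun _ : Site 3 1 => d) u) (gaugeTransform (fun _ : Site 3 1 => d) u) p / transferKernel su2Rep ((L : ℝ) ^ 3 * β) u u =
      fpTriple L β Ω W 1 1 p / transferKernel su2Rep ((L : ℝ) ^ 3 * β) (1 : GaugeConfig 3 1 SU2) 1 *
        Real.exp (diagX L β (gaugeTransform (fun _ : Site 3 1 => d) u) p.1 p.2.1 p.2.2) := by
  have hK : transferKernel su2Rep ((L : ℝ) ^ 3 * β) u u =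
      transferKernel su2Rep ((L : ℝ) ^ 3 * β) (gaugeTransform (fun _ : Site 3 1 => d) u) (gaugeTransform (fun _ : Site 3 1 => d) u) := (transferKernel_conj_conj _ d u u).symm
  rw [hK]
  unfold fpTriple
  have h := transferKernel_orthoTube_diag_div_one_site (L := L) β (gaugeTransform (fun _ : Site 3 1 => d) u) p.1 p.2.1 p.2.2
  calc Ω (linkEmbed L p.1) * (W p.2.2 * transferKernel su2Rep β (orthoTube L (gaugeTransform (fun _ : Site 3 1 => d) u) p.1)
        (gaugeTransform p.2.2 (orthoTube L (gaugeTransform (fun _ : Site 3 1 => d) u) p.2.1)) * Ω (linkEmbed L p.2.1)) /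
        transferKernel su2Rep ((L : ℝ) ^ 3 * β) (gaugeTransform (fun _ : Site 3 1 => d) u) (gaugeTransform (fun _ : Site 3 1 => d) u)
      = Ω (linkEmbed L p.1) * (W p.2.2 * Ω (linkEmbed L p.2.1)) *
          (transferKernel su2Rep β (orthoTube L (gaugeTransform (fun _ : Site 3 1 => d) u) p.1) (gaugeTransform p.2.2 (orthoTube L (gaugeTransform (fun _ : Site 3 1 => d) u) p.2.1)) /
            transferKernel su2Rep ((L : ℝ) ^ 3 * β) (gaugeTransform (fun _ : Site 3 1 => d) u) (gaugeTransform (fun _ : Site 3 1 => d) u)) := by ring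
    _ = Ω (linkEmbed L p.1) * (W p.2.2 * Ω (linkEmbed L p.2.1)) *
          (transferKernel su2Rep β (orthoTube L 1 p.1) (gaugeTransform p.2.2 (orthoTube L 1 p.2.1)) / transferKernel su2Rep ((L : ℝ) ^ 3 * β) (1 : GaugeConfig 3 1 SU2) 1 *
            Real.exp (diagX L β (gaugeTransform (fun _ : Site 3 1 => d) u) p.1 p.2.1 p.2.2)) := by rw [h]
    _ = _ := by ring

/-! ## §2 ★★★ The two-sided diagonal comparison -/

/-- ★★★ **(L3)**: for colour-blind `Ω ≥ 0` (bounded measurable, supported where the cap coordinates are `≤ τ ≤ 1/30`) and a conjugation-invariant `W ≥ 0` (bounded measurable), if the explicit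
second-order quantities are `≤ ε₁, ε₂` uniformly on `supp Ω × supp Ω × supp W` for the slow datum `u` (`Σ_a u⃗_{k,a}² ≤ τu²`, `L³S₁(u) ≤ σ`), then
`(1 − ε₂)·f(1) ≤ f(u) ≤ (1 + ε₂ + (ε₁+ε₂)²)·f(1)`, `f(u) = fpBOKernel β Ω W u u / K₁^{(L³β)}(u,u)`. [cite: Luscher1983, §3] -/
theorem fpBOKernel_diag_two_sided {β : ℝ} (hβ : 0 ≤ β) {Ω : LinkSpace L → ℝ} (hΩm : Measurable Ω) {CΩ : ℝ} (hCΩ : ∀ x, |Ω x| ≤ CΩ) (hΩ0 : ∀ x, 0 ≤ Ω x)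
    (hΩinv : ∀ (g : SU2) (x : LinkSpace L), Ω (adL L g x) = Ω x) {W : (Site 3 L → SU2) → ℝ} (hW : Measurable W) {CW : ℝ} (hCW : ∀ g, |W g| ≤ CW) (hW0 : ∀ g, 0 ≤ W g)
    (hWinv : ∀ (c : SU2) (g : Site 3 L → SU2), W (fun x => c * g x * c⁻¹) = W g)
    (u : GaugeConfig 3 1 SU2) {τ σ τu : ℝ} (hτ : τ ≤ 1 / 30) (hσ : σ < 2) (hσ0 : 0 ≤ σ) (hS : (L : ℝ) ^ 3 * wilsonAction su2Rep u ≤ σ)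
    (hΩτ : ∀ v : Edge 3 L → Fin 3 → ℝ, Ω (linkEmbed L v) ≠ 0 → ∀ (e : Edge 3 L) (c : Fin 3), |v e c| ≤ τ)
    (hτu0 : 0 ≤ τu) (hτu : τu ≤ 1) (hu : ∀ k : Fin 3, ∑ a, vecPart (u (0, k)) a ^ 2 ≤ τu ^ 2) {ε₁ ε₂ : ℝ} (hε : ε₁ + ε₂ ≤ 1)
    (hε₁ : ∀ (v v' : Edge 3 L → Fin 3 → ℝ) (g : Site 3 L → SU2), Ω (linkEmbed L v) ≠ 0 → Ω (linkEmbed L v') ≠ 0 → W g ≠ 0 →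
      β * (12 * ∑ e : Edge 3 L, (2 * τu) * ‖vecPart (g (e.1.shift e.2))‖ * ‖vecPart (linkM L v v' g e)‖) +
        β * (40 * (2 * τu) * (Fintype.card (Plaquette 3 L × Fin 3) : ℝ) * (‖linkEmbed L v‖ ^ 2 + ‖linkEmbed L v'‖ ^ 2)) ≤ ε₁)
    (hε₂ : ∀ (v v' : Edge 3 L → Fin 3 → ℝ) (g : Site 3 L → SU2), Ω (linkEmbed L v) ≠ 0 → Ω (linkEmbed L v') ≠ 0 → W g ≠ 0 →
      β * (48 * ∑ e : Edge 3 L, τu ^ 2 * ‖vecPart (g (e.1.shift e.2))‖ * ‖vecPart (linkM L v v' g e)‖) +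
        β / 2 * ((σ / 2 * (10 * Real.sqrt (Fintype.card (Plaquette 3 L × Fin 3)) * ‖linkEmbed L v‖) ^ 2 + stepActionErr (L := L) τ σ) + stepActionErr (L := L) τ 0 +
          145000000 * (Fintype.card (Plaquette 3 L × Fin 3) : ℝ) * τu ^ 2 * ‖linkEmbed L v‖ ^ 2) +
        β / 2 * ((σ / 2 * (10 * Real.sqrt (Fintype.card (Plaquette 3 L × Fin 3)) * ‖linkEmbed L v'‖) ^ 2 + stepActionErr (L := L) τ σ) + stepActionErr (L := L) τ 0 +
          145000000 * (Fintype.card (Plaquette 3 L × Fin 3) : ℝ) * τu ^ 2 * ‖linkEmbed L v'‖ ^ 2) ≤ ε₂) :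
    (1 - ε₂) * (fpBOKernel L β Ω W 1 1 / transferKernel su2Rep ((L : ℝ) ^ 3 * β) (1 : GaugeConfig 3 1 SU2) 1) ≤
        fpBOKernel L β Ω W u u / transferKernel su2Rep ((L : ℝ) ^ 3 * β) u u ∧
      fpBOKernel L β Ω W u u / transferKernel su2Rep ((L : ℝ) ^ 3 * β) u u ≤
        (1 + ε₂ + (ε₁ + ε₂) ^ 2) * (fpBOKernel L β Ω W 1 1 / transferKernel su2Rep ((L : ℝ) ^ 3 * β) (1 : GaugeConfig 3 1 SU2) 1) := by
  haveI := isFiniteMeasure_orthoTransverse L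
  haveI : SecondCountableTopology SU2 := secondCountableTopology_su2
  set μP : Measure ((Edge 3 L → Fin 3 → ℝ) × ((Edge 3 L → Fin 3 → ℝ) × (Site 3 L → SU2))) := (orthoTransverse L).prod ((orthoTransverse L).prod (gaugeMeasure L)) with hμP
  haveI : IsFiniteMeasure μP := by rw [hμP]; infer_instance
  set K1 : ℝ := transferKernel su2Rep ((L : ℝ) ^ 3 * β) (1 : GaugeConfig 3 1 SU2) 1 with hK1
  set Ku : ℝ := transferKernel su2Rep ((L : ℝ) ^ 3 * β) u u with hKu
  have hK1p : 0 < K1 := transferKernel_pos _ _ _ _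
  have hKup : 0 < Ku := transferKernel_pos _ _ _ _
  -- the reference density `ρ₁ ≥ 0`
  set ρ : ((Edge 3 L → Fin 3 → ℝ) × ((Edge 3 L → Fin 3 → ℝ) × (Site 3 L → SU2))) → ℝ := fun p => fpTriple L β Ω W 1 1 p / K1 with hρ
  obtain ⟨B, hB⟩ := abs_fpTriple_le (L := L) β hCΩ hCW (1 : GaugeConfig 3 1 SU2) 1
  have hB0 : 0 ≤ B := (abs_nonneg _).trans (hB (0, (0, 1)))
  have hρm : Measurable ρ := (measurable_fpTriple β hΩm hW 1 1).div_const _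
  have hρ0 : ∀ p, 0 ≤ ρ p := fun p => by
    rw [hρ]; dsimp only; unfold fpTriple
    exact div_nonneg (mul_nonneg (hΩ0 _) (mul_nonneg (mul_nonneg (hW0 _) (transferKernel_pos _ _ _ _).le) (hΩ0 _))) hK1p.le
  have hρb : ∀ p, |ρ p| ≤ B / K1 := fun p => by rw [hρ]; dsimp only; rw [abs_div, abs_of_pos hK1p]; exact div_le_div_of_nonneg_right (hB p) hK1p.le
  have hρint : Integrable ρ μP := integrable_of_measurable_abs_le _ hρm hρb
  -- f(1) = ∫ ρ
  have hf1 : fpBOKernel L β Ω W 1 1 / K1 = ∫ p, ρ p ∂μP := by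
    rw [hρ, integral_div, hμP, ← fpBOKernel_eq_integral_prod β hΩm hCΩ hW hCW]
  -- f(u) = ∫_d ∫_P ρ·exp(diagX(dud⁻¹))
  have hfu_conj : ∀ d : SU2, fpBOKernel L β Ω W (gaugeTransform (fun _ : Site 3 1 => d) u) (gaugeTransform (fun _ : Site 3 1 => d) u) / Ku =
      ∫ p, ρ p * Real.exp (diagX L β (gaugeTransform (fun _ : Site 3 1 => d) u) p.1 p.2.1 p.2.2) ∂μP := fun d => by
    rw [hμP, fpBOKernel_eq_integral_prod β hΩm hCΩ hW hCW, ← integral_div]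
    refine integral_congr_ae (ae_of_all _ fun p => ?_)
    dsimp only
    rw [hKu, fpTriple_conj_div_eq, hρ]
  have hfu : fpBOKernel L β Ω W u u / Ku = ∫ d, ∫ p, ρ p * Real.exp (diagX L β (gaugeTransform (fun _ : Site 3 1 => d) u) p.1 p.2.1 p.2.2) ∂μP ∂haarProbability SU2 := by
    have hconst : ∀ d : SU2, fpBOKernel L β Ω W (gaugeTransform (fun _ : Site 3 1 => d) u) (gaugeTransform (fun _ : Site 3 1 => d) u) / Ku = fpBOKernel L β Ω W u u / Ku :=
      fun d => by rw [fpBOKernel_conj β hΩm hΩinv hW hWinv d u u]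
    simp_rw [← hfu_conj, hconst]
    simp
  -- Fubini: the joint integrand is bounded measurable
  set G : SU2 × ((Edge 3 L → Fin 3 → ℝ) × ((Edge 3 L → Fin 3 → ℝ) × (Site 3 L → SU2))) → ℝ :=
    fun q => ρ q.2 * Real.exp (diagX L β (gaugeTransform (fun _ : Site 3 1 => q.1) u) q.2.1 q.2.2.1 q.2.2.2) with hG
  have hGeq : ∀ q : SU2 × ((Edge 3 L → Fin 3 → ℝ) × ((Edge 3 L → Fin 3 → ℝ) × (Site 3 L → SU2))),
      G q = fpTriple L β Ω W (gaugeTransform (fun _ : Site 3 1 => q.1) u) (gaugeTransform (fun _ : Site 3 1 => q.1) u) q.2 / Ku := fun q => by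
    rw [hG]; dsimp only; rw [hKu, fpTriple_conj_div_eq, hρ]
  have hGm : Measurable G := by
    have hfun : G = fun q : SU2 × ((Edge 3 L → Fin 3 → ℝ) × ((Edge 3 L → Fin 3 → ℝ) × (Site 3 L → SU2))) =>
        fpTriple L β Ω W (gaugeTransform (fun _ : Site 3 1 => q.1) u) (gaugeTransform (fun _ : Site 3 1 => q.1) u) q.2 / Ku := funext hGeq
    rw [hfun]
    refine Measurable.div_const ?_ _
    -- joint measurability of `(d, p) ↦ fpTriple (dud⁻¹) (dud⁻¹) p`
    have hK : Measurable fun r : GaugeConfig 3 L SU2 × GaugeConfig 3 L SU2 => transferKernel su2Rep β r.1 r.2 :=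
      (continuous_transferKernel su2Rep continuous_su2Rep β).measurable
    have hc : Measurable fun q : SU2 × ((Edge 3 L → Fin 3 → ℝ) × ((Edge 3 L → Fin 3 → ℝ) × (Site 3 L → SU2))) => gaugeTransform (fun _ : Site 3 1 => q.1) u :=
      (measurable_constGaugeAction_left (L := 1) u).comp measurable_fst
    have hU : Measurable fun q : SU2 × ((Edge 3 L → Fin 3 → ℝ) × ((Edge 3 L → Fin 3 → ℝ) × (Site 3 L → SU2))) =>
        orthoTube L (gaugeTransform (fun _ : Site 3 1 => q.1) u) q.2.1 := by
      have h := (measurable_orthoTube L).comp (hc.prodMk (measurable_fst.comp measurable_snd))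
      simpa only [Function.comp_def] using h
    have hV : Measurable fun q : SU2 × ((Edge 3 L → Fin 3 → ℝ) × ((Edge 3 L → Fin 3 → ℝ) × (Site 3 L → SU2))) =>
        gaugeTransform q.2.2.2 (orthoTube L (gaugeTransform (fun _ : Site 3 1 => q.1) u) q.2.2.1) := by
      have h1 : Measurable fun q : SU2 × ((Edge 3 L → Fin 3 → ℝ) × ((Edge 3 L → Fin 3 → ℝ) × (Site 3 L → SU2))) =>
          orthoTube L (gaugeTransform (fun _ : Site 3 1 => q.1) u) q.2.2.1 := by
        have h := (measurable_orthoTube L).comp (hc.prodMk (measurable_fst.comp (measurable_snd.comp measurable_snd)))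
        simpa only [Function.comp_def] using h
      have h := (measurable_gaugeAction (L := L)).comp (h1.prodMk (measurable_snd.comp (measurable_snd.comp measurable_snd)))
      simpa only [Function.comp_def] using h
    have hKq : Measurable fun q : SU2 × ((Edge 3 L → Fin 3 → ℝ) × ((Edge 3 L → Fin 3 → ℝ) × (Site 3 L → SU2))) =>
        transferKernel su2Rep β (orthoTube L (gaugeTransform (fun _ : Site 3 1 => q.1) u) q.2.1)
          (gaugeTransform q.2.2.2 (orthoTube L (gaugeTransform (fun _ : Site 3 1 => q.1) u) q.2.2.1)) := by
      have h := hK.comp (hU.prodMk hV); simpa only [Function.comp_def] using h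
    unfold fpTriple
    exact (hΩm.comp ((measurable_linkEmbed L).comp (measurable_fst.comp measurable_snd))).mul
      (((hW.comp (measurable_snd.comp (measurable_snd.comp measurable_snd))).mul hKq).mul
        (hΩm.comp ((measurable_linkEmbed L).comp (measurable_fst.comp (measurable_snd.comp measurable_snd)))))
  -- a bound on `G`, uniform in the conjugate (the constants of `fpTriple` do not depend on the slow datum)
  obtain ⟨M, hM⟩ := exists_transferKernel_le su2Rep continuous_su2Rep β (L := L)
  have hCΩ0 : 0 ≤ CΩ := (abs_nonneg _).trans (hCΩ 0)
  have hCW0 : 0 ≤ CW := (abs_nonneg _).trans (hCW 1)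
  have hM0 : 0 ≤ M := (transferKernel_pos su2Rep β (1 : GaugeConfig 3 L SU2) 1).le.trans (hM 1 1)
  have habs : ∀ (w w' : GaugeConfig 3 1 SU2) (q : (Edge 3 L → Fin 3 → ℝ) × ((Edge 3 L → Fin 3 → ℝ) × (Site 3 L → SU2))), |fpTriple L β Ω W w w' q| ≤ CΩ * ((CW * M) * CΩ) :=
    fun w w' q => by
      unfold fpTriple
      rw [abs_mul, abs_mul, abs_mul, abs_of_pos (transferKernel_pos su2Rep β _ _)]
      exact mul_le_mul (hCΩ _) (mul_le_mul (mul_le_mul (hCW _) (hM _ _) (transferKernel_pos su2Rep β _ _).le hCW0) (hCΩ _) (abs_nonneg _) (mul_nonneg hCW0 hM0))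
        (mul_nonneg (mul_nonneg (abs_nonneg _) (transferKernel_pos su2Rep β _ _).le) (abs_nonneg _)) hCΩ0
  have hGb : ∀ q, |G q| ≤ CΩ * ((CW * M) * CΩ) / Ku := fun q => by
    rw [hGeq, abs_div, abs_of_pos hKup]; exact div_le_div_of_nonneg_right (habs _ _ _) hKup.le
  have hGint : Integrable G ((haarProbability SU2).prod μP) := integrable_of_measurable_abs_le _ hGm hGb
  -- Fubini
  have hswap : ∫ d, ∫ p, ρ p * Real.exp (diagX L β (gaugeTransform (fun _ : Site 3 1 => d) u) p.1 p.2.1 p.2.2) ∂μP ∂haarProbability SU2 =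
      ∫ p, ∫ d, G (d, p) ∂haarProbability SU2 ∂μP := by
    have h := integral_integral_swap (f := fun d p => G (d, p)) hGint
    simpa only [hG] using h
  have hinner_int : Integrable (fun p => ∫ d, G (d, p) ∂haarProbability SU2) μP := hGint.swap.integral_prod_left
  -- the caps hold almost everywhere
  have hcapπ : ∀ᵐ v ∂orthoTransverse L, v ∈ capBalancedSet L := by
    rw [ae_iff]; have h0 := orthoTransverse_compl_capBalancedSet L; simpa only [Set.compl_def] using h0
  have hcap1 : ∀ᵐ p ∂μP, p.1 ∈ capBalancedSet L := by
    rw [hμP]; exact (Measure.quasiMeasurePreserving_fst (μ := orthoTransverse L) (ν := (orthoTransverse L).prod (gaugeMeasure L))).ae hcapπ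
  have hcap2 : ∀ᵐ p ∂μP, p.2.1 ∈ capBalancedSet L := by
    rw [hμP]
    have h2 : ∀ᵐ q ∂((orthoTransverse L).prod (gaugeMeasure L)), q.1 ∈ capBalancedSet L :=
      (Measure.quasiMeasurePreserving_fst (μ := orthoTransverse L) (ν := gaugeMeasure L)).ae hcapπ
    exact (Measure.quasiMeasurePreserving_snd (μ := orthoTransverse L) (ν := (orthoTransverse L).prod (gaugeMeasure L))).ae h2
  -- the pointwise sandwich, a.e. in `p`
  have hpt : ∀ᵐ p ∂μP, (1 - ε₂) * ρ p ≤ ∫ d, G (d, p) ∂haarProbability SU2 ∧ ∫ d, G (d, p) ∂haarProbability SU2 ≤ (1 + ε₂ + (ε₁ + ε₂) ^ 2) * ρ p := by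
    filter_upwards [hcap1, hcap2] with p hv hv'
    have hI : ∫ d, G (d, p) ∂haarProbability SU2 = ρ p * ∫ d, Real.exp (diagX L β (gaugeTransform (fun _ : Site 3 1 => d) u) p.1 p.2.1 p.2.2) ∂haarProbability SU2 := by
      rw [hG]; dsimp only; rw [integral_const_mul]
    rw [hI]
    by_cases hρp : ρ p = 0
    · rw [hρp]; simp
    · -- the support conditions
      have hne : fpTriple L β Ω W 1 1 p ≠ 0 := by
        intro h0; apply hρp; rw [hρ]; dsimp only; rw [h0, zero_div]
      have hΩv : Ω (linkEmbed L p.1) ≠ 0 := by intro h0; apply hne; unfold fpTriple; rw [h0, zero_mul]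
      have hΩv' : Ω (linkEmbed L p.2.1) ≠ 0 := by intro h0; apply hne; unfold fpTriple; rw [h0, mul_zero, mul_zero]
      have hWg : W p.2.2 ≠ 0 := by intro h0; apply hne; unfold fpTriple; rw [h0, zero_mul, zero_mul, mul_zero]
      have hsand := haar_integral_exp_diagX_sandwich (L := L) hβ u hv hv' hτ hσ hσ0 hS (hΩτ _ hΩv) (hΩτ _ hΩv') hτu0 hτu hu p.2.2
        (hε₁ p.1 p.2.1 p.2.2 hΩv hΩv' hWg) (hε₂ p.1 p.2.1 p.2.2 hΩv hΩv' hWg) hε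
      have hρp0 : 0 ≤ ρ p := hρ0 p
      constructor
      · calc (1 - ε₂) * ρ p = ρ p * (1 - ε₂) := mul_comm _ _
          _ ≤ ρ p * ∫ d, Real.exp (diagX L β (gaugeTransform (fun _ : Site 3 1 => d) u) p.1 p.2.1 p.2.2) ∂haarProbability SU2 :=
              mul_le_mul_of_nonneg_left hsand.1 hρp0
      · calc ρ p * ∫ d, Real.exp (diagX L β (gaugeTransform (fun _ : Site 3 1 => d) u) p.1 p.2.1 p.2.2) ∂haarProbability SU2
            ≤ ρ p * (1 + ε₂ + (ε₁ + ε₂) ^ 2) := mul_le_mul_of_nonneg_left hsand.2 hρp0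
          _ = (1 + ε₂ + (ε₁ + ε₂) ^ 2) * ρ p := mul_comm _ _
  -- integrate
  rw [hfu, hswap, hf1]
  constructor
  · rw [← integral_const_mul]
    exact integral_mono_ae (hρint.const_mul _) hinner_int (hpt.mono fun p hp => hp.1)
  · rw [← integral_const_mul]
    exact integral_mono_ae hinner_int (hρint.const_mul _) (hpt.mono fun p hp => hp.2)

end Summit.QuantumFields.YangMills.Theorems.FemtoTransferGap.TwoLattice.ConstTube

end
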